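import Literature.NumberTheory.EllipticCurves.SemistableModPImageFiveProofs
import Literature.NumberTheory.EllipticCurves.VariableChangePointsMap
import Literature.NumberTheory.EllipticCurves.GlobalMinimalModelProofs
import Literature.NumberTheory.DiophantineGeometry.LocalReductionProofs
import Literature.NumberTheory.DiophantineGeometry.GeneralizedFermatTwoPowerCoefficientFreySaitoProofs
import HarnessLib

/-!
# Discharge of `Edixhoven1997_prop_2_1` (Serre 1972, §5.4 Prop. 21 / Edixhoven 1997, Prop. 2.1)

`Proofs` file (theorems only), topic `NumberTheory/EllipticCurves`: the named fact
`Literature.NumberTheory.EllipticCurves.Edixhoven1997_prop_2_1` of `SemistableModPImage.lean` —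
for a semistable elliptic curve `E/ℚ` and a prime `p`, `ρ̄_{E,p}` is onto or `E[p]` has a
`Γ_ℚ`-stable line on which, or modulo which, `Γ_ℚ` acts trivially — is PROVED
(`Edixhoven1997_prop_2_1_holds`) from the two halves established in the sibling files for curves
in global minimal form over `𝓞 ℚ`:

* irreducible ⇒ onto: `WeierstrassCurve.hasSurjectiveModNGaloisRep_of_hasIrreducibleModPGaloisRep_of_isSemistable`
  (`SemistableModPImageIrreducibleProofs`, `SemistableModPImageFiveProofs`; Serre §5.4 Prop. 21 i),
  Edixhoven after Oesterlé for `p ≤ 5`);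
* reducible ⇒ semi-simplification `1 ⊕ χ̄_p`: `WeierstrassCurve.smul_eq_or_smul_sub_mem_of_isSemistable`
  (`SemistableModPImageReducibleProofs`; Prop. 21 ii), Lemmes 5–6).

The reduction to global minimal form: a global minimal model `C • E` exists over `ℚ`
(`hasGlobalMinimalModel_rat_holds`), semistability is model-independent
(`isSemistable_smul_iff_holds`) and reads the same over `ℤ` and over `𝓞 ℚ`
(the tree's `DiophantineGeometry.isSemistable_ringOfIntegers_of_isSemistable_int`), and
`E[p] ≅ (C • E)[p]` equivariantly
(`VariableChange.pointEquivBaseChange`).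

## References

* [Edixhoven1997] B. Edixhoven, *Serre's conjecture*, in Cornell–Silverman–Stevens (1997),
  Prop. 2.1 (PDF p. 285).
* [Serre1972] J.-P. Serre, Invent. Math. 15 (1972), §5.4 Prop. 21.
-/

noncomputable section

open scoped Classical NumberField
open IsDedekindDomain Field

namespace Literature.NumberTheory.EllipticCurves

open _root_.WeierstrassCurve Rat.HeightOneSpectrum NumberField

/-- **Serre 1972, §5.4, Prop. 21 = Edixhoven 1997, Prop. 2.1 (after Oesterlé) — discharge of the
named fact `Edixhoven1997_prop_2_1`.**  For a semistable elliptic curve `E/ℚ` and a prime `p`: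
`ρ̄_{E,p}` is onto, or there is a `Γ_ℚ`-stable subgroup `H ⊂ E[p]`, `H ≠ 0, E[p]`, fixed pointwise
by `Γ_ℚ` or with `Γ_ℚ` acting trivially on `E[p]/H`.  Proof: pass to a global minimal model
`E' = C • E` (semistable over `𝓞 ℚ`); if `E'[p]` is irreducible, `ρ̄_{E',p}` is onto
(`hasSurjectiveModNGaloisRep_of_hasIrreducibleModPGaloisRep_of_isSemistable`) and so is `ρ̄_{E,p}`
(`hasSurjectiveModNGaloisRep_of_isogeny_bijective`); otherwise a stable line `H'` of `E'[p]` has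
the dichotomy of `smul_eq_or_smul_sub_mem_of_isSemistable`, transported to `E[p]` along the
equivariant `E[p] ≅ E'[p]`.
[cite: Edixhoven1997, Prop. 2.1 (PDF p. 285)] [cite: Serre1972, §5.4 Prop. 21] -/
theorem Edixhoven1997_prop_2_1_holds : Edixhoven1997_prop_2_1 := by
  intro W _ hW p hp
  haveI : Fact p.Prime := ⟨hp⟩
  -- a global minimal model `W' = C • W`, semistable over `𝓞 ℚ`
  obtain ⟨C, hC⟩ := hasGlobalMinimalModel_rat_holds W
  haveI := hC
  set W' : WeierstrassCurve ℚ := C • W with hW'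
  haveI : W'.IsElliptic := by rw [hW']; infer_instance
  have hsemi : W'.IsSemistable (𝓞 ℚ) :=
    DiophantineGeometry.isSemistable_ringOfIntegers_of_isSemistable_int W'
      ((isSemistable_smul_iff_holds ℤ W C).mpr hW)
  -- the equivariant `E[p] ≅ E'[p]`
  let e : geomPoints W ≃+ geomPoints W' :=
    VariableChange.pointEquivBaseChange W C (AlgebraicClosure ℚ)
  have hsmul : ∀ (σ : absoluteGaloisGroup ℚ) (P : geomPoints W), e (σ • P) = σ • e P := fun σ P ↦
    VariableChange.pointEquivBaseChange_map_algEquiv W C (absoluteGaloisGroup.toAlgEquiv ℚ σ) P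
  have htor : ∀ {P : geomPoints W}, P ∈ geomTorsion W p ↔ e P ∈ geomTorsion W' p := by
    intro P
    rw [geomTorsion, geomTorsion, AddSubgroup.torsionBy.nsmul_iff, AddSubgroup.torsionBy.nsmul_iff,
      ← map_nsmul, AddEquiv.map_eq_zero_iff]
  let ε : geomTorsion W p ≃+ geomTorsion W' p :=
    { toFun := fun P ↦ ⟨e P, htor.mp P.2⟩
      invFun := fun Q ↦ ⟨e.symm Q, by rw [htor, e.apply_symm_apply]; exact Q.2⟩
      left_inv := fun P ↦ Subtype.ext (e.symm_apply_apply _)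
      right_inv := fun Q ↦ Subtype.ext (e.apply_symm_apply _)
      map_add' := fun P Q ↦ Subtype.ext (by
        change e ((P : geomPoints W) + Q) = e P + e Q
        exact map_add e _ _) }
  have hε : ∀ (σ : absoluteGaloisGroup ℚ) (P : geomTorsion W p), ε (σ • P) = σ • ε P :=
    fun σ P ↦ Subtype.ext (by
      change e ((σ • P : geomTorsion W p) : geomPoints W) = _
      rw [AddSubgroup.torsionBy.coe_smul, hsmul]
      rfl)
  have hε' : ∀ (σ : absoluteGaloisGroup ℚ) (Q : geomTorsion W' p), ε.symm (σ • Q) = σ • ε.symm Q :=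
    fun σ Q ↦ by
      apply ε.injective
      rw [hε, ε.apply_symm_apply, ε.apply_symm_apply]
  by_cases hirr : W'.HasIrreducibleModPGaloisRep p
  · -- irreducible: onto
    left
    exact hasSurjectiveModNGaloisRep_of_isogeny_bijective (VariableChange.toIsogeny W C)
      ⟨VariableChange.toIsogeny_injective W C, VariableChange.toIsogeny_surjective W C⟩ p
      (W'.hasSurjectiveModNGaloisRep_of_hasIrreducibleModPGaloisRep_of_isSemistable hsemi p hirr)
  · -- reducible: a stable line `H'` of `E'[p]`, and its dichotomy
    right
    unfold HasIrreducibleModPGaloisRep at hirr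
    push Not at hirr
    obtain ⟨H', hst', hbot', htop'⟩ := hirr
    have hdich := W'.smul_eq_or_smul_sub_mem_of_isSemistable p hsemi H' hst' hbot' htop'
    set H : AddSubgroup (geomTorsion W p) := H'.comap ε.toAddMonoidHom with hHdef
    have hmem : ∀ P : geomTorsion W p, P ∈ H ↔ ε P ∈ H' := fun P ↦ Iff.rfl
    refine ⟨H, fun σ P hP ↦ ?_, ?_, ?_, ?_⟩
    · rw [hmem] at hP ⊢
      rw [hε]
      exact hst' σ _ hP
    · intro hH
      apply hbot'
      rw [eq_bot_iff]
      intro Q hQ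
      have hQ' : ε.symm Q ∈ H := by rw [hmem, ε.apply_symm_apply]; exact hQ
      rw [hH, AddSubgroup.mem_bot] at hQ'
      rw [AddSubgroup.mem_bot, ← ε.apply_symm_apply Q, hQ', map_zero]
    · intro hH
      apply htop'
      rw [eq_top_iff]
      intro Q _
      have hQ' : ε.symm Q ∈ H := hH ▸ AddSubgroup.mem_top _
      rw [hmem, ε.apply_symm_apply] at hQ'
      exact hQ'
    · rcases hdich with hfix | hquot
      · left
        intro σ P hP
        rw [hmem] at hP
        apply ε.injective
        rw [hε]
        exact hfix σ _ hP
      · right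
        intro σ P
        rw [hmem, map_sub, hε]
        exact hquot σ (ε P)

end Literature.NumberTheory.EllipticCurves

end
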